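import Literature.Topology.FourManifolds.PropertyRTraceClosing
import Literature.Topology.FourManifolds.LevelPassageSurgery
import Literature.Topology.FourManifolds.MorseDiscLemma
import Literature.Topology.FourManifolds.CobordismEndLevelsDiffeo
import Literature.Topology.FourManifolds.SPC4HandlesCancelStep
import Literature.Topology.FourManifolds.LickorishTwistLink
import Literature.Topology.FourManifolds.ConnectedSumSphereIdentity
import Literature.Topology.FourManifolds.ConnectedSumTransportProofs
import Literature.Topology.FourManifolds.AdaptedMorseConnected
import Literature.Topology.FourManifolds.ImmersionOrientation
import Literature.Topology.FourManifolds.LickorishWallaceProofs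
import Literature.Topology.FourManifolds.GradientLikeExistence
import Literature.Topology.FourManifolds.RegularDomainMaps
import Literature.Geometry.Manifold.EmbeddingRangeDiffeomorph
import HarnessLib

/-!
# The boundary of a `4`-dimensional `(1,0,1)`-handlebody is an integral surgery on a knot

Topic `Literature/Topology/FourManifolds`; fact seat
`provefact-Literature.Topology.FourManifolds.exists-762b5f508d` of the named fact (T)
`Literature.Topology.FourManifolds.exists_framedKnot_of_hasHandleDecomposition_oneZeroOne`
(`PropertyRTraceClosing.lean`; Kirby, *The topology of 4-manifolds* (1989), Ch. I §1 and §2,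
p. 8: the `4`-manifold `M_L` of a framed link `L ⊂ S³ = ∂B⁴` *"is a smooth 4-manifold with
boundary `∂M_L`"*, the surgery on `L`; Milnor, *Lectures on the h-cobordism theorem* (1965),
Thm. 3.13 with §3 p. 21: the level above a critical point of index `λ` is the surgery
`χ(V, φ_L)` of the level below it).  Everything here is **proved**; no definition and no named
fact is introduced.  This file lands **clause (i)** of the fact:

* `exists_knot_isIntegralSurgery_of_hasHandleDecomposition_oneZeroOne` — for a compact smooth
  `4`-manifold with boundary `P` with a handle decomposition with one `0`-handle, no `1`-handle,
  one `2`-handle and nothing else, and any boundary datum `bP`, there are a knot `K : Knot` and a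
  framing `n : ℤ` with `IsIntegralSurgery (𝓡 3) bP.carrier K n` (`DehnSurgery.lean`);
* `exists_passageData_isIntegralSurgery_of_hasHandleDecomposition_oneZeroOne` — the same with the
  construction recorded (Morse function, field, passage setting, the level `V ≅ S³`, the oriented
  tube and its framing), and
  `exists_framedKnot_of_hasHandleDecomposition_oneZeroOne_of_closing` — the fact follows from
  its closing clause (ii) for the knot of that construction, spelled out as a hypothesis; and
  `exists_framedKnot_of_hasHandleDecomposition_oneZeroOne_of_model` — the fact follows from a
  closed-up model `S⁴ = P₀ ∪ V₀` (`SphereFourOneZeroOneSplitting.lean`) and the uniqueness of the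
  trace of the `0`-framed unknot (`P ≅ P₀`, hypothesis).

## The argument (Milnor 1965, §3; Kirby 1989, Ch. I §§1–2)

Let `f` be the adapted Morse function, `p` its critical point of index `0` (the minimum) and `q`
the one of index `2`.  View `P` as the triad `(P; ∅, ∂P)` (`Cobordism.ofBoundary`) and rescale
`f` into Milnor's normalisation `g` (`IsMorseAdapted.exists_isMorseFunction_ofBoundary`); take a
smooth gradient-like field (`Cobordism.Milnor1965_exists_isGradientLike_holds`) and levels
`g p < b < g q < b₂ < 1`.  Then:

* the level `V = g⁻¹(b)` bounds the sublevel set `{g ≤ b}`, a compact manifold with boundary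
  carrying an adapted Morse function with the single critical point `p`, of index `0`
  (`exists_isManifold_sublevel_of_le`, Milnor 1965, Lemma 2.9), hence a `4`-disc
  (`IsMorseAdapted.nonempty_diffeomorph_closedBall`, Milnor 1963, Thm. 3.1 with the Lemma of
  Morse), so `V ≅ ∂𝔻⁴ = S³` (`BoundaryData.restrictDiffeomorph` and
  `nonempty_diffeomorph_boundary_of_range_eq` below);
* the level `V₂ = g⁻¹(b₂)`, `b₂` close to `1`, is diffeomorphic to `∂P` (Milnor 1965, Thm. 3.4 /
  Cor. 3.5 on the reversed triad, `Cobordism.IsMorseFunction.exists_pos_nonempty_diffeomorph_level`);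
* `V₂` is obtained from `V` by surgery along the tube of the left-hand circle of `q` (Milnor 1965,
  Thm. 3.13 and §3 p. 21, the tree's `Cobordism.PassageSetting.isOpenGluing_tube`): an open gluing
  of `V ∖ S_L(b)` and `D̊² × S¹` along `ν(σ, t u) ∼ (t σ, u)` — literally the shape of the Dehn
  surgery relation `surgeryRel` of `DehnSurgery.lean`;
* transporting along the two diffeomorphisms, `∂P` is an open gluing of the complement of the knot
  `K = Φ ∘ S_L` in `S³` and the open solid torus along the relation of the tube `T = Φ ∘ ν`; the
  tube or its fibre reflection is an oriented tubular neighbourhood of `K`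
  (`LickorishTwist.exists_tubularNbhd_of_tube`) and has a framing integer
  (`Knot.TubularNbhd.exists_hasFraming`), which gives `IsIntegralSurgery (𝓡 3) ∂P K n`, and
  finally `∂P ≅ bP.carrier` for any boundary datum (`BoundaryData.restrictDiffeomorph` of the
  identity; transport by `IsIntegralSurgery.of_diffeomorph`).

## References

* R. C. Kirby, *The topology of 4-manifolds*, LNM 1374 (1989), Ch. I §1 (handles and Morse
  functions), §2 p. 8 (`M_L` and `∂M_L`). [Kirby1989]
* J. Milnor, *Lectures on the h-cobordism theorem* (1965), Def. 3.1, Lemma 2.9, Thm. 3.4,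
  Cor. 3.5, Def. 3.9–3.11, Thms. 3.12–3.13, §3 p. 21. [MilnorHCobordism1965]
* J. Milnor, *Morse theory* (1963), Thms. 3.1–3.2. [Milnor1963]
* D. Rolfsen, *Knots and Links* (1976), §9.F (integral surgery). [Rolfsen1976]

## Design notes

* A sibling file of `PropertyRTraceClosing.lean` named for the result; universe `0` for `P`, as
  in the fact (the gluing transports require the pieces in one universe).
* Clause (ii) of the fact (the `0`-framed unknot trace closes up to the round `S⁴` with a
  `(1,1)`-handlebody complement) is not proved here; it is isolated as the hypothesis of
  `exists_framedKnot_of_hasHandleDecomposition_oneZeroOne_of_closing`.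
-/

open scoped Manifold ContDiff Topology
open Set Function Filter Metric

noncomputable section

namespace Literature.Topology.FourManifolds

/-! ### The critical data of a `(1,0,1)`-handlebody -/

section CriticalData

variable {k : ℕ} {M : Type*} [TopologicalSpace M] [T2Space M] [CompactSpace M]
  [ChartedSpace (EuclideanHalfSpace (k + 1)) M] [IsManifold (𝓡∂ (k + 1)) ∞ M]

omit [T2Space M] [IsManifold (𝓡∂ (k + 1)) ∞ M] in
/-- **The critical point of index `0` is the minimum.**  For a Morse function adapted to the
boundary of a compact manifold whose critical points of index `0` reduce to `p`, `f p ≤ f x`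
for every `x`, and `f p < f x` for every other critical point `x`: a minimum point is interior
(`f = 1` on the boundary, `f p < 1`), hence critical of index `0`
(`morseIndex_eq_zero_of_isLocalMin_of_isInteriorPoint`), hence `p`. [cite: Milnor1963, proof of Thm. 4.1 (p. 25)] -/
theorem IsMorseAdapted.apply_le_and_apply_lt_of_criticalSetOfIndex_zero {f : M → ℝ}
    (hf : IsMorseAdapted (𝓡∂ (k + 1)) f) {p : M}
    (h0 : criticalSetOfIndex (𝓡∂ (k + 1)) f 0 = {p}) :
    (∀ x, f p ≤ f x) ∧
      ∀ x, IsMCriticalPt (𝓡∂ (k + 1)) f x → x ≠ p → f p < f x := by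
  have hcont : Continuous f := hf.1.1.continuous
  haveI : Nonempty M := ⟨p⟩
  have hpmem : p ∈ criticalSetOfIndex (𝓡∂ (k + 1)) f 0 := by rw [h0]; exact mem_singleton p
  have hpint : (𝓡∂ (k + 1)).IsInteriorPoint p := hf.isInteriorPoint_of_isMCriticalPt hpmem.1
  have hfp1 : f p < 1 := hf.2.2 p hpint
  -- every global minimum point is `p`
  have hmin : ∀ x, IsMinOn f univ x → x = p := by
    intro x hx
    have hxp : f x ≤ f p := isMinOn_iff.1 hx p (mem_univ p)
    have hxint : (𝓡∂ (k + 1)).IsInteriorPoint x := by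
      refine ((𝓡∂ (k + 1)).isInteriorPoint_or_isBoundaryPoint x).resolve_right fun hb => ?_
      have h1 : f x = 1 := (hf.2.1 x hb).1
      linarith
    have hloc : IsLocalMin f x := hx.isLocalMin univ_mem
    have hxmem : x ∈ criticalSetOfIndex (𝓡∂ (k + 1)) f 0 :=
      ⟨isMCriticalPt_of_isLocalMin hloc hxint,
        morseIndex_eq_zero_of_isLocalMin_of_isInteriorPoint (hf.isMorse.contMDiffAt_two x) hloc hxint⟩
    rw [h0] at hxmem
    exact hxmem
  obtain ⟨x₀, -, hx₀⟩ := isCompact_univ.exists_isMinOn univ_nonempty hcont.continuousOn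
  have hx₀p : x₀ = p := hmin x₀ hx₀
  rw [hx₀p] at hx₀
  have hle : ∀ x, f p ≤ f x := fun x => isMinOn_iff.1 hx₀ x (mem_univ x)
  refine ⟨hle, fun x _ hxp => lt_of_le_of_ne (hle x) fun heq => hxp (hmin x ?_)⟩
  exact isMinOn_iff.2 fun y _ => by rw [← heq]; exact hle y

variable [SecondCountableTopology M]

omit [T2Space M] [SecondCountableTopology M] in
/-- **The critical data of a `(1,0,1)`-handlebody.**  An adapted Morse function presenting a
handle decomposition with one `0`-handle, no `1`-handle, one `2`-handle and nothing else has
exactly two critical points `p ≠ q`, of indices `0` and `2` (finiteness of the critical set,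
`IsMorse.finite_criticalSet_holds`, turns the counts into equalities of sets). [cite: Milnor1963, Thms. 3.2 and 3.5] -/
theorem IsMorseAdapted.exists_criticalSet_eq_pair_of_oneZeroOne {f : M → ℝ}
    (hf : IsMorseAdapted (𝓡∂ (k + 1)) f)
    (hcount : ∀ j, (criticalSetOfIndex (𝓡∂ (k + 1)) f j).ncard =
      (fun j => if j = 0 then 1 else if j = 2 then 1 else 0) j) :
    ∃ p q : M, criticalSetOfIndex (𝓡∂ (k + 1)) f 0 = {p} ∧
      criticalSetOfIndex (𝓡∂ (k + 1)) f 2 = {q} ∧ criticalSet (𝓡∂ (k + 1)) f = {p, q} ∧ p ≠ q := by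
  have hfin : (criticalSet (𝓡∂ (k + 1)) f).Finite := IsMorse.finite_criticalSet_holds hf.isMorse
  have hfin' : ∀ j, (criticalSetOfIndex (𝓡∂ (k + 1)) f j).Finite := fun j =>
    hfin.subset (criticalSetOfIndex_subset _ f j)
  have h0 : (criticalSetOfIndex (𝓡∂ (k + 1)) f 0).ncard = 1 := by rw [hcount 0]; simp
  have h2 : (criticalSetOfIndex (𝓡∂ (k + 1)) f 2).ncard = 1 := by rw [hcount 2]; simp
  have hj : ∀ j, j ≠ 0 → j ≠ 2 → criticalSetOfIndex (𝓡∂ (k + 1)) f j = ∅ := fun j hj0 hj2 => by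
    rw [← Set.ncard_eq_zero (hfin' j), hcount j]
    simp [hj0, hj2]
  obtain ⟨p, hp⟩ := Set.ncard_eq_one.1 h0
  obtain ⟨q, hq⟩ := Set.ncard_eq_one.1 h2
  have hpmem : p ∈ criticalSetOfIndex (𝓡∂ (k + 1)) f 0 := by rw [hp]; exact mem_singleton p
  have hqmem : q ∈ criticalSetOfIndex (𝓡∂ (k + 1)) f 2 := by rw [hq]; exact mem_singleton q
  refine ⟨p, q, hp, hq, ?_, fun hpq => ?_⟩
  · ext z
    simp only [mem_insert_iff, mem_singleton_iff, mem_criticalSet]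
    constructor
    · intro hz
      have hzk : z ∈ criticalSetOfIndex (𝓡∂ (k + 1)) f (morseIndex (𝓡∂ (k + 1)) f z) := ⟨hz, rfl⟩
      by_cases h0' : morseIndex (𝓡∂ (k + 1)) f z = 0
      · rw [h0', hp] at hzk; exact Or.inl hzk
      by_cases h2' : morseIndex (𝓡∂ (k + 1)) f z = 2
      · rw [h2', hq] at hzk; exact Or.inr hzk
      rw [hj _ h0' h2'] at hzk
      exact hzk.elim
    · rintro (rfl | rfl)
      · exact hpmem.1
      · exact hqmem.1
  · rw [hpq] at hpmem
    have := hpmem.2.symm.trans hqmem.2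
    exact absurd this (by norm_num)

end CriticalData

/-! ### Two presentations of a level: an embedded level manifold and the boundary of a domain -/

section LevelBoundary

variable {k : ℕ} {M : Type*} [TopologicalSpace M] [ChartedSpace (EuclideanHalfSpace (k + 1)) M]
  {D : Type*} [TopologicalSpace D] [ChartedSpace (EuclideanHalfSpace (k + 1)) D]
  [IsManifold (𝓡∂ (k + 1)) ∞ D]
  {V : Type*} [TopologicalSpace V] [ChartedSpace (EuclideanSpace ℝ (Fin k)) V]

/-- **A manifold smoothly embedded onto the image of the boundary of an embedded domain is
diffeomorphic to that boundary.**  If `jD : D → M` is a smooth embedding of manifolds with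
boundary and `ι : V → M` a smooth embedding of a boundaryless manifold with
`range ι = jD(∂D)`, then `V ≅ ∂D` (the boundary subtype with its structure
`BoundaryManifold.chartedSpace`): `ι` factors smoothly through `jD`
(`Literature.Geometry.Manifold.exists_contMDiff_comp_eq_of_range_subset`, Lee 2013, Cor. 5.30)
and then through `∂D` (`BoundaryManifold.contMDiff_codRestrict`); the inverse is smooth by the
universal property of the immersion `ι` (Mathlib's `ContMDiff.iff_comp_isImmersion`).
[cite: LeeSmoothManifolds2013, Thm. 5.11, Cor. 5.30 and Thm. 5.31] -/
theorem nonempty_diffeomorph_boundary_of_range_eq {jD : D → M}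
    (hjD : Manifold.IsSmoothEmbedding (𝓡∂ (k + 1)) (𝓡∂ (k + 1)) ∞ jD) {ι : V → M}
    (hι : Manifold.IsSmoothEmbedding (𝓡 k) (𝓡∂ (k + 1)) ∞ ι)
    (h : range ι = jD '' ((𝓡∂ (k + 1)).boundary D)) :
    Nonempty (V ≃ₘ⟮𝓡 k, 𝓡 k⟯ ((𝓡∂ (k + 1)).boundary D)) := by
  -- factor `ι` through `jD`
  obtain ⟨ι', hι', hcomp⟩ := Literature.Geometry.Manifold.exists_contMDiff_comp_eq_of_range_subset
    hjD hι.contMDiff (by rw [h]; exact image_subset_range _ _)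
  have hcomp' : ∀ v, jD (ι' v) = ι v := fun v => congrFun hcomp v
  have hB : ∀ v, ι' v ∈ (𝓡∂ (k + 1)).boundary D := fun v => by
    have hv : ι v ∈ jD '' ((𝓡∂ (k + 1)).boundary D) := h ▸ mem_range_self v
    obtain ⟨d, hd, hdv⟩ := hv
    rw [← hcomp'] at hdv
    rwa [← hjD.isEmbedding.injective hdv]
  -- the forward map
  set F : V → (𝓡∂ (k + 1)).boundary D := ((𝓡∂ (k + 1)).boundary D).codRestrict ι' hB with hF
  have hFs : ContMDiff (𝓡 k) (𝓡 k) ∞ F := BoundaryManifold.contMDiff_codRestrict hB hι'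
  -- the backward map through the homeomorphism `V ≃ range ι`
  let Ψ : V ≃ₜ range ι := hι.isEmbedding.toHomeomorph
  have hmem : ∀ x : (𝓡∂ (k + 1)).boundary D, jD x.1 ∈ range ι := fun x => by
    rw [h]; exact mem_image_of_mem jD x.2
  set G : (𝓡∂ (k + 1)).boundary D → V := fun x => Ψ.symm ⟨jD x.1, hmem x⟩ with hG
  have hΨ : ∀ y : range ι, ι (Ψ.symm y) = y := by
    rintro ⟨_, x, rfl⟩
    exact congrArg ι (hι.isEmbedding.toHomeomorph_symm_apply x)
  have hιG : ∀ x, ι (G x) = jD x.1 := fun x => hΨ _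
  have hGs : ContMDiff (𝓡 k) (𝓡 k) ∞ G := by
    rw [ContMDiff.iff_comp_isImmersion hι.isImmersion]
    refine ⟨Ψ.symm.continuous.comp ?_, ?_⟩
    · exact (hjD.contMDiff.continuous.comp continuous_subtype_val).subtype_mk _
    · have : ι ∘ G = jD ∘ Subtype.val := funext hιG
      rw [this]
      exact hjD.contMDiff.comp
        (BoundaryManifold.isSmoothEmbedding_subtype_val (n := k) (W := D)).contMDiff
  have hGF : ∀ v, G (F v) = v := fun v => hι.isEmbedding.injective (by
    rw [hιG]; exact hcomp' v)
  have hFG : ∀ x, F (G x) = x := fun x => by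
    apply Subtype.ext
    apply hjD.isEmbedding.injective
    show jD (ι' (G x)) = jD x.1
    rw [hcomp', hιG]
  exact ⟨⟨⟨F, G, hGF, hFG⟩, hFs, hGs⟩⟩

end LevelBoundary

/-! ### The level just above the minimum is a `3`-sphere -/

section SphereLevel

variable {P : Type} [TopologicalSpace P] [T2Space P] [CompactSpace P]
  [ChartedSpace (EuclideanHalfSpace 4) P] [IsManifold (𝓡∂ 4) ∞ P]

/-- **A regular level between the minimum and the second critical value of an adapted Morse
function on a compact `4`-manifold with boundary is a `3`-sphere.**  If the critical set of `g`
is `{p, q}` with `p` of index `0` and `g p < b < g q`, the sublevel set `{g ≤ b}` is a compact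
manifold with boundary the level `g⁻¹(b)` carrying an adapted Morse function with the single
critical point `p`, of index `0` (Milnor 1965, Lemma 2.9, `exists_isManifold_sublevel_of_le`),
hence a `4`-disc (Milnor 1963, Thm. 3.1 with the Lemma of Morse,
`IsMorseAdapted.nonempty_diffeomorph_closedBall`), whose boundary is `S³`
(`BoundaryData.restrictDiffeomorph`, `closedBallBoundaryData`); any presentation of the level
is diffeomorphic to that boundary (`nonempty_diffeomorph_boundary_of_range_eq`).
[cite: Milnor1963, Thm. 3.1 and proof of Thm. 4.1 (p. 25)] [cite: MilnorHCobordism1965, Lemma 2.9] -/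
theorem nonempty_diffeomorph_sphere_three_of_level {g : P → ℝ} (hg : IsMorseAdapted (𝓡∂ 4) g)
    {p q : P} (hcrit : criticalSet (𝓡∂ 4) g = {p, q}) (h0 : morseIndex (𝓡∂ 4) g p = 0)
    {b : ℝ} (hpb : g p < b) (hbq : b < g q) (hb1 : b < 1)
    (V : Type) [TopologicalSpace V] [ChartedSpace (EuclideanSpace ℝ (Fin 3)) V] [IsManifold (𝓡 3) ∞ V]
    (ι : V → P) (hι : Manifold.IsSmoothEmbedding (𝓡 3) (𝓡∂ 4) ∞ ι) (hιr : range ι = g ⁻¹' {b}) :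
    Nonempty (V ≃ₘ⟮𝓡 3, 𝓡 3⟯ (Metric.sphere (0 : EuclideanSpace ℝ (Fin 4)) 1)) := by
  have hcont : Continuous g := hg.1.1.continuous
  have hreg : ∀ z, IsMCriticalPt (𝓡∂ 4) g z → g z ≠ b := by
    intro z hz
    have hz' : z ∈ criticalSet (𝓡∂ 4) g := hz
    rw [hcrit] at hz'
    rcases hz' with rfl | rfl
    · exact hpb.ne
    · exact hbq.ne'
  obtain ⟨cs, mf, hemb, hF, hcritF, hidxF⟩ :=
    exists_isManifold_sublevel_of_le (k := 3) le_add_self P g b hg hb1 hreg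
  letI : ChartedSpace (EuclideanHalfSpace (3 + 1)) ↥(g ⁻¹' Iic b) := cs
  haveI : IsManifold (𝓡∂ (3 + 1)) ∞ ↥(g ⁻¹' Iic b) := mf
  haveI : CompactSpace ↥(g ⁻¹' Iic b) :=
    isCompact_iff_compactSpace.1 ((isClosed_Iic.preimage hcont).isCompact)
  -- the only critical point of the restricted function is `p`
  set p' : ↥(g ⁻¹' Iic b) := ⟨p, hpb.le⟩ with hp'
  have hpc : IsMCriticalPt (𝓡∂ 4) g p := by
    have : p ∈ criticalSet (𝓡∂ 4) g := by rw [hcrit]; exact mem_insert p {q}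
    exact this
  have hp'c : IsMCriticalPt (𝓡∂ (3 + 1)) (fun x : ↥(g ⁻¹' Iic b) => g x + (1 - b)) p' :=
    (hcritF p').2 hpc
  have huniq : ∀ x, IsMCriticalPt (𝓡∂ (3 + 1)) (fun x : ↥(g ⁻¹' Iic b) => g x + (1 - b)) x → x = p' := by
    intro x hx
    have hxc : IsMCriticalPt (𝓡∂ 4) g x.1 := (hcritF x).1 hx
    have hx' : x.1 ∈ criticalSet (𝓡∂ 4) g := hxc
    rw [hcrit] at hx'
    rcases hx' with h | h
    · exact Subtype.ext h
    · exfalso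
      have hxb : g x.1 ≤ b := x.2
      rw [h] at hxb
      linarith
  have h0' : morseIndex (𝓡∂ (3 + 1)) (fun x : ↥(g ⁻¹' Iic b) => g x + (1 - b)) p' = 0 :=
    (hidxF p' hpc).trans h0
  obtain ⟨Φ₁⟩ := IsMorseAdapted.nonempty_diffeomorph_closedBall (k := 3) le_add_self hF hp'c huniq h0'
  -- the boundary of the disc is the `3`-sphere
  haveI : Fact (isSmoothEmbedding_sphereInclusion' 3) := ⟨isSmoothEmbedding_sphereInclusion'_holds 3⟩
  let e₁ : ((𝓡∂ (3 + 1)).boundary ↥(g ⁻¹' Iic b)) ≃ₘ⟮𝓡 3, 𝓡 3⟯ (Metric.sphere (0 : EuclideanSpace ℝ (Fin 4)) 1) :=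
    (BoundaryManifold.boundaryData 3 ↥(g ⁻¹' Iic b)).restrictDiffeomorph (closedBallBoundaryData 3) Φ₁
  -- the boundary of the sublevel set is the level
  have hbd : (𝓡∂ (3 + 1)).boundary ↥(g ⁻¹' Iic b) = {x | g x.1 = b} := by
    ext x
    constructor
    · intro hx
      have := (hF.2.1 x hx).1
      simp only at this
      show g x.1 = b
      linarith
    · intro hx
      by_contra hxb
      have hxi : (𝓡∂ (3 + 1)).IsInteriorPoint x :=
        ((𝓡∂ (3 + 1)).isInteriorPoint_iff_not_isBoundaryPoint x).2 hxb
      have := hF.2.2 x hxi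
      simp only at this
      have hx' : g x.1 = b := hx
      linarith
  have hrange : range ι = Subtype.val '' ((𝓡∂ (3 + 1)).boundary ↥(g ⁻¹' Iic b)) := by
    rw [hιr, hbd]
    ext y
    simp only [mem_preimage, mem_singleton_iff, mem_image, mem_setOf_eq, Subtype.exists,
      exists_and_right, exists_eq_right, mem_Iic]
    exact ⟨fun hy => ⟨hy.le, hy⟩, fun ⟨_, hy⟩ => hy⟩
  obtain ⟨e₀⟩ := nonempty_diffeomorph_boundary_of_range_eq hemb hι hrange
  exact ⟨e₀.trans e₁⟩

end SphereLevel

/-! ### From a tube in `S³` and an open gluing along its relation to an integral surgery -/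

section TubeSurgery

variable {Y : Type*} [TopologicalSpace Y] [ChartedSpace (EuclideanSpace ℝ (Fin 3)) Y]

/-- **A `3`-manifold glued from the complement of the core of a smoothly embedded tube
`T : S¹ × ℝ² ↪ S³` and the open solid torus along the relation of `T` is an integral surgery on
the core knot.**  The tube or its fibre reflection is an oriented tubular neighbourhood of the
core (`LickorishTwist.exists_tubularNbhd_of_tube`; in the reflected case the solid torus is
reflected by `LickorishTwist.torusFlip`, transport of gluings along diffeomorphisms of the
pieces, `IsOpenGluing.comp_diffeomorph_pieces`), and an oriented tubular neighbourhood has a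
framing integer (`Knot.TubularNbhd.exists_hasFraming`).  Rolfsen, *Knots and Links* (1976),
§9.F. [cite: Rolfsen1976, §9.F] -/
theorem exists_isIntegralSurgery_of_isOpenGluing_tubeRel {T : (Metric.sphere (0 : EuclideanSpace ℝ (Fin 2)) 1) × (EuclideanSpace ℝ (Fin 2)) → (Metric.sphere (0 : EuclideanSpace ℝ (Fin 4)) 1)}
    (hT : Manifold.IsSmoothEmbedding ((𝓡 1).prod 𝓘(ℝ, (EuclideanSpace ℝ (Fin 2)))) (𝓡 3) ∞ T)
    (hG : IsOpenGluing (𝓡 3) (𝓘(ℝ, (EuclideanSpace ℝ (Fin 2))).prod (𝓡 1)) (𝓡 3)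
      (A := (LickorishTwist.knotOfTube hT).complement) (B := solidTorus) (P := Y)
      fun a b => LickorishTwist.tubeRel T (a : (Metric.sphere (0 : EuclideanSpace ℝ (Fin 4)) 1)) (b : (EuclideanSpace ℝ (Fin 2)) × (Metric.sphere (0 : EuclideanSpace ℝ (Fin 2)) 1))) :
    ∃ m : ℤ, IsIntegralSurgery (𝓡 3) Y (LickorishTwist.knotOfTube hT) m := by
  obtain ⟨ν, -, hrel | hrel⟩ := LickorishTwist.exists_tubularNbhd_of_tube hT
  · obtain ⟨m, hm⟩ := ν.exists_hasFraming
    exact ⟨m, ν, hm, hG.of_forall_iff fun a b => (hrel a b).symm⟩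
  · obtain ⟨m, hm⟩ := ν.exists_hasFraming
    refine ⟨m, ν, hm, ?_⟩
    have h' := hG.comp_diffeomorph_pieces (Diffeomorph.refl (𝓡 3) _ ∞) LickorishTwist.torusFlip
    refine h'.of_forall_iff fun a b => ?_
    simp only [Diffeomorph.coe_refl, id_eq, LickorishTwist.coe_torusFlip,
      LickorishTwist.coe_torusFlipFun]
    exact (hrel a _).symm

/-- **The same, with the oriented tube recorded**: the oriented tubular neighbourhood `ν` of the
core knot is the tube `T` itself or its fibre reflection `(x, (w₀, w₁)) ↦ T (x, (w₀, -w₁))`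
(`fibreReflect`; `Knot.TubularNbhd.ofLocalDiffeomorph_apply_or`), it has a framing integer `m`
(`Knot.TubularNbhd.exists_hasFraming`), and the glued manifold is the `m`-surgery on the core
(in the reflected case the solid torus is reflected by `LickorishTwist.torusFlip`).  Rolfsen,
*Knots and Links* (1976), §9.F. [cite: Rolfsen1976, §9.F] -/
theorem exists_tubularNbhd_hasFraming_isIntegralSurgery_of_isOpenGluing_tubeRel
    {T : (Metric.sphere (0 : EuclideanSpace ℝ (Fin 2)) 1) × (EuclideanSpace ℝ (Fin 2)) → (Metric.sphere (0 : EuclideanSpace ℝ (Fin 4)) 1)}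
    (hT : Manifold.IsSmoothEmbedding ((𝓡 1).prod 𝓘(ℝ, (EuclideanSpace ℝ (Fin 2)))) (𝓡 3) ∞ T)
    (hG : IsOpenGluing (𝓡 3) (𝓘(ℝ, (EuclideanSpace ℝ (Fin 2))).prod (𝓡 1)) (𝓡 3)
      (A := (LickorishTwist.knotOfTube hT).complement) (B := solidTorus) (P := Y)
      fun a b => LickorishTwist.tubeRel T (a : (Metric.sphere (0 : EuclideanSpace ℝ (Fin 4)) 1)) (b : (EuclideanSpace ℝ (Fin 2)) × (Metric.sphere (0 : EuclideanSpace ℝ (Fin 2)) 1))) :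
    ∃ (ν : Knot.TubularNbhd ⇑(LickorishTwist.knotOfTube hT)) (m : ℤ),
      (⇑ν = T ∨ ⇑ν = fibreReflect T) ∧ ν.HasFraming m ∧
        IsIntegralSurgery (𝓡 3) Y (LickorishTwist.knotOfTube hT) m := by
  have hinj : Injective T := hT.isEmbedding.injective
  set ν := Knot.TubularNbhd.ofLocalDiffeomorph (K := LickorishTwist.knotOfTube hT)
    (LickorishTwist.isLocalDiffeomorph_of_tube hT) hinj (fun x => rfl) with hν
  obtain ⟨m, hm⟩ := ν.exists_hasFraming
  rcases Knot.TubularNbhd.ofLocalDiffeomorph_apply_or (K := LickorishTwist.knotOfTube hT)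
    (LickorishTwist.isLocalDiffeomorph_of_tube hT) hinj (fun x => rfl) with h | h
  · have hcoe : (⇑ν : (Metric.sphere (0 : EuclideanSpace ℝ (Fin 2)) 1) × (EuclideanSpace ℝ (Fin 2)) → (Metric.sphere (0 : EuclideanSpace ℝ (Fin 4)) 1)) = T := by rw [hν]; exact funext h
    refine ⟨ν, m, Or.inl hcoe, hm, ν, hm, hG.of_forall_iff fun a b => ?_⟩
    show (∃ (u : (Metric.sphere (0 : EuclideanSpace ℝ (Fin 2)) 1)) (t : ℝ), t ∈ Ioo (0 : ℝ) 1 ∧ (b : (EuclideanSpace ℝ (Fin 2)) × (Metric.sphere (0 : EuclideanSpace ℝ (Fin 2)) 1)).1 = t • (u : (EuclideanSpace ℝ (Fin 2))) ∧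
        (a : (Metric.sphere (0 : EuclideanSpace ℝ (Fin 4)) 1)) = T (u, t • ((b : (EuclideanSpace ℝ (Fin 2)) × (Metric.sphere (0 : EuclideanSpace ℝ (Fin 2)) 1)).2 : (EuclideanSpace ℝ (Fin 2))))) ↔
      ∃ (u : (Metric.sphere (0 : EuclideanSpace ℝ (Fin 2)) 1)) (t : ℝ), t ∈ Ioo (0 : ℝ) 1 ∧ (b : (EuclideanSpace ℝ (Fin 2)) × (Metric.sphere (0 : EuclideanSpace ℝ (Fin 2)) 1)).1 = t • (u : (EuclideanSpace ℝ (Fin 2))) ∧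
        (a : (Metric.sphere (0 : EuclideanSpace ℝ (Fin 4)) 1)) = ν (u, t • ((b : (EuclideanSpace ℝ (Fin 2)) × (Metric.sphere (0 : EuclideanSpace ℝ (Fin 2)) 1)).2 : (EuclideanSpace ℝ (Fin 2))))
    rw [hcoe]
  · have hcoe : (⇑ν : (Metric.sphere (0 : EuclideanSpace ℝ (Fin 2)) 1) × (EuclideanSpace ℝ (Fin 2)) → (Metric.sphere (0 : EuclideanSpace ℝ (Fin 4)) 1)) = fibreReflect T := by rw [hν]; exact funext h
    have h' := hG.comp_diffeomorph_pieces (Diffeomorph.refl (𝓡 3) _ ∞) LickorishTwist.torusFlip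
    refine ⟨ν, m, Or.inr hcoe, hm, ν, hm, h'.of_forall_iff fun a b => ?_⟩
    simp only [Diffeomorph.coe_refl, id_eq, LickorishTwist.coe_torusFlip,
      LickorishTwist.coe_torusFlipFun]
    show (∃ (u : (Metric.sphere (0 : EuclideanSpace ℝ (Fin 2)) 1)) (t : ℝ), t ∈ Ioo (0 : ℝ) 1 ∧ (b : (EuclideanSpace ℝ (Fin 2)) × (Metric.sphere (0 : EuclideanSpace ℝ (Fin 2)) 1)).1 = t • (u : (EuclideanSpace ℝ (Fin 2))) ∧
        (a : (Metric.sphere (0 : EuclideanSpace ℝ (Fin 4)) 1)) = T (u, t • ((reflectLast 1 (b : (EuclideanSpace ℝ (Fin 2)) × (Metric.sphere (0 : EuclideanSpace ℝ (Fin 2)) 1)).2 : (Metric.sphere (0 : EuclideanSpace ℝ (Fin 2)) 1)) : (EuclideanSpace ℝ (Fin 2))))) ↔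
      ∃ (u : (Metric.sphere (0 : EuclideanSpace ℝ (Fin 2)) 1)) (t : ℝ), t ∈ Ioo (0 : ℝ) 1 ∧ (b : (EuclideanSpace ℝ (Fin 2)) × (Metric.sphere (0 : EuclideanSpace ℝ (Fin 2)) 1)).1 = t • (u : (EuclideanSpace ℝ (Fin 2))) ∧
        (a : (Metric.sphere (0 : EuclideanSpace ℝ (Fin 4)) 1)) = ν (u, t • ((b : (EuclideanSpace ℝ (Fin 2)) × (Metric.sphere (0 : EuclideanSpace ℝ (Fin 2)) 1)).2 : (EuclideanSpace ℝ (Fin 2))))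
    rw [hcoe]
    simp only [fibreReflect, LickorishTwist.planeFlip_smul_coe]

end TubeSurgery

/-! ### Clause (i): the boundary of a `(1,0,1)`-handlebody is an integral surgery on a knot -/

section Main

/-- **The surgery data of a `(1,0,1)`-handlebody** (the construction behind
`exists_knot_isIntegralSurgery_of_hasHandleDecomposition_oneZeroOne`, recorded for the closing
clause of the fact `exists_framedKnot_of_hasHandleDecomposition_oneZeroOne`): a Morse function `g`
on the triad `(P; ∅, ∂P)` with critical set `{p, q}` of indices `0`, `2`, a smooth gradient-like
field `ξ`, Milnor's passage setting `Ps` about `q` (Thm. 3.13), a presentation `ι : V ↪ P` of the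
lower level `g⁻¹(b)` with a diffeomorphism `Φ : V ≅ S³` (the level bounds the `4`-disc below it,
Milnor 1963, Thm. 3.1), the oriented tubular neighbourhood `ν` of the knot
`K = Φ ∘ S_L(q)` which is the transported tube `Φ ∘ ν_L` of the left-hand circle or its fibre
reflection, its framing integer `n`, and the conclusion `bP.carrier = S³ₙ(K)`.
[cite: MilnorHCobordism1965, Thm. 3.13 with §3 p. 21, Thm. 3.4 and Cor. 3.5]
[cite: Kirby1989, Ch. I §1 and §2 (p. 8)] [cite: Milnor1963, Thm. 3.1] -/
theorem exists_passageData_isIntegralSurgery_of_hasHandleDecomposition_oneZeroOne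
    (P : Type) [TopologicalSpace P] [T2Space P] [SecondCountableTopology P]
    [ChartedSpace (EuclideanHalfSpace 4) P] [IsManifold (𝓡∂ 4) ∞ P] [CompactSpace P]
    (hP : HasHandleDecomposition 3 P (fun k => if k = 0 then 1 else if k = 2 then 1 else 0))
    (bP : BoundaryData (𝓡∂ 4) P (𝓡 3)) :
    ∃ (g : P → ℝ) (_ : (Cobordism.ofBoundary 3 P).IsMorseFunction g) (p q : P)
      (_ : criticalSet (𝓡∂ (3 + 1)) g = {p, q}) (_ : morseIndex (𝓡∂ (3 + 1)) g p = 0)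
      (_ : morseIndex (𝓡∂ (3 + 1)) g q = 2)
      (ξ : Cₛ^∞⟮𝓡∂ (3 + 1); EuclideanSpace ℝ (Fin (3 + 1)),
        (TangentSpace (𝓡∂ (3 + 1)) : P → Type)⟯)
      (_ : IsGradientLike (𝓡∂ (3 + 1)) g ξ)
      (Ps : Cobordism.PassageSetting (Cobordism.ofBoundary 3 P) g ⇑ξ 1) (_ : Ps.q = q)
      (V : Type) (_ : TopologicalSpace V) (_ : T2Space V) (_ : ChartedSpace (EuclideanSpace ℝ (Fin 3)) V)
      (_ : IsManifold (𝓡 3) ∞ V) (_ : Nonempty V) (ι : V → P)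
      (hι : Manifold.IsSmoothEmbedding (𝓡 3) (𝓡∂ (3 + 1)) ∞ ι) (hιr : range ι = g ⁻¹' {Ps.b})
      (Φ : V ≃ₘ⟮𝓡 3, 𝓡 3⟯ (Metric.sphere (0 : EuclideanSpace ℝ (Fin 4)) 1))
      (ν : Knot.TubularNbhd
        ⇑(LickorishTwist.knotOfTube ((Ps.isSmoothEmbedding_tubePH ι hι hιr).diffeomorph_comp Φ)))
      (n : ℤ),
      (⇑ν = ⇑Φ ∘ ⇑(Ps.tubePH ι hι hιr) ∨ ⇑ν = fibreReflect (⇑Φ ∘ ⇑(Ps.tubePH ι hι hιr))) ∧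
        ν.HasFraming n ∧
        IsIntegralSurgery (𝓡 3) bP.carrier
          (LickorishTwist.knotOfTube ((Ps.isSmoothEmbedding_tubePH ι hι hιr).diffeomorph_comp Φ)) n := by
  haveI : ConnectedSpace P := hP.connectedSpace (by simp)
  haveI : LocallyPathConnectedSpace P :=
    ChartedSpace.locallyPathConnectedSpace (EuclideanHalfSpace 4) P
  obtain ⟨f, hf, hcount⟩ := hP
  obtain ⟨p, q, hf0, hf2, hfcrit, hpq⟩ := hf.exists_criticalSet_eq_pair_of_oneZeroOne hcount
  ------------------------------------------------------------------------------------------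
  -- Step 1: the triad `(P; ∅, ∂P)` and Milnor's normalisation `g = s f + (1 - s)`
  ------------------------------------------------------------------------------------------
  haveI : CompactSpace ((𝓡∂ (3 + 1)).boundary P) := compactSpace_boundary 3 P
  obtain ⟨s, hs, hg, hSg⟩ := hf.exists_isMorseFunction_ofBoundary
  set g : P → ℝ := fun y => s * f y + (1 - s) with hgdef
  have hgA : IsMorseAdapted (𝓡∂ (3 + 1)) g := hg.isMorseAdapted_ofBoundary
  have hgcont : Continuous g := hgA.1.1.continuous
  have hg0 : criticalSetOfIndex (𝓡∂ (3 + 1)) g 0 = {p} := (hSg 0).trans hf0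
  have hg2 : criticalSetOfIndex (𝓡∂ (3 + 1)) g 2 = {q} := (hSg 2).trans hf2
  have hgcrit : criticalSet (𝓡∂ (3 + 1)) g = {p, q} := by
    rw [← iUnion_criticalSetOfIndex, ← hfcrit, ← iUnion_criticalSetOfIndex]
    exact iUnion_congr hSg
  have hpmem : p ∈ criticalSetOfIndex (𝓡∂ (3 + 1)) g 0 := by rw [hg0]; exact mem_singleton p
  have hqmem : q ∈ criticalSetOfIndex (𝓡∂ (3 + 1)) g 2 := by rw [hg2]; exact mem_singleton q
  have hpint : (𝓡∂ (3 + 1)).IsInteriorPoint p := hgA.isInteriorPoint_of_isMCriticalPt hpmem.1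
  have hqint : (𝓡∂ (3 + 1)).IsInteriorPoint q := hgA.isInteriorPoint_of_isMCriticalPt hqmem.1
  obtain ⟨hle, hlt⟩ := hgA.apply_le_and_apply_lt_of_criticalSetOfIndex_zero hg0
  have hpq' : g p < g q := hlt q hqmem.1 (Ne.symm hpq)
  have hq1 : g q < 1 := hgA.2.2 q hqint
  have hp0 : 0 < g p := (hg.2.2.2.2 p hpint).1
  -- indices: `≤ 2` everywhere, so the boundary is nonempty
  have hidx : ∀ x, (𝓡∂ (3 + 1)).IsInteriorPoint x → IsMCriticalPt (𝓡∂ (3 + 1)) g x →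
      morseIndex (𝓡∂ (3 + 1)) g x + 2 ≤ 3 + 1 := by
    intro x _ hx
    have hx' : x ∈ criticalSet (𝓡∂ (3 + 1)) g := hx
    rw [hgcrit] at hx'
    rcases hx' with rfl | rfl
    · rw [hpmem.2]; norm_num
    · rw [hqmem.2]
  obtain ⟨-, y₁, hy₁⟩ := hgA.isPreconnected_boundary_and_nonempty hidx
  have hgy₁ : g y₁ = 1 := (hgA.2.1 y₁ hy₁).1
  ------------------------------------------------------------------------------------------
  -- Step 2: a gradient-like field, the upper collar, the two levels
  ------------------------------------------------------------------------------------------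
  obtain ⟨ξ, hξ⟩ := Cobordism.Milnor1965_exists_isGradientLike_holds hg
  obtain ⟨ε₀, hε₀, hlev⟩ := hg.symm.exists_pos_nonempty_diffeomorph_level
  obtain ⟨b, hpb, hbq⟩ : ∃ b : ℝ, g p < b ∧ b < g q := ⟨(g p + g q) / 2, by linarith, by linarith⟩
  obtain ⟨b₂, hqb₂, hb₂1, hb₂ε⟩ : ∃ b₂ : ℝ, g q < b₂ ∧ b₂ < 1 ∧ 1 - b₂ ≤ ε₀ := by
    refine ⟨max ((g q + 1) / 2) (1 - ε₀), ?_, ?_, ?_⟩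
    · exact lt_of_lt_of_le (by linarith) (le_max_left _ _)
    · exact max_lt (by linarith) (by linarith)
    · have := le_max_right ((g q + 1) / 2) (1 - ε₀); linarith
  have hb0 : 0 < b := hp0.trans hpb
  have hb1 : b < 1 := hbq.trans hq1
  have hb₂0 : 0 < b₂ := hb0.trans (hbq.trans hqb₂)
  have honly : ∀ z ∈ criticalSet (𝓡∂ (3 + 1)) g, g z ∈ Icc b b₂ → z = q := by
    intro z hz hzI
    rw [hgcrit] at hz
    rcases hz with rfl | rfl
    · exact absurd hzI.1 (not_le.2 hpb)
    · rfl
  have hregb : ∀ z, IsMCriticalPt (𝓡∂ (3 + 1)) g z → g z ≠ b := by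
    intro z hz
    have hz' : z ∈ criticalSet (𝓡∂ (3 + 1)) g := hz
    rw [hgcrit] at hz'
    rcases hz' with rfl | rfl
    · exact hpb.ne
    · exact hbq.ne'
  have hregb₂ : ∀ z, IsMCriticalPt (𝓡∂ (3 + 1)) g z → g z ≠ b₂ := by
    intro z hz
    have hz' : z ∈ criticalSet (𝓡∂ (3 + 1)) g := hz
    rw [hgcrit] at hz'
    rcases hz' with rfl | rfl
    · exact (hpb.trans (hbq.trans hqb₂)).ne
    · exact hqb₂.ne
  -- the passage setting about `q`
  have hq11 : q ∈ criticalSetOfIndex (𝓡∂ (3 + 1)) g (1 + 1) := hqmem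
  obtain ⟨Ps, hPq, hPb, hPb₂⟩ :=
    hg.exists_passageSetting ξ hξ (k := 1) (by norm_num) hq11 hb0 hbq hqb₂ hb₂1 honly
  -- presentations of the two levels
  obtain ⟨V, _, _, _, _, _, _, ι, hι, hιr⟩ :=
    hg.exists_isSmoothEmbedding_range_eq (a := b) ⟨hb0, hb1⟩ hregb
  obtain ⟨V₂, _, _, _, _, _, _, ι₂, hι₂, hι₂r⟩ :=
    hg.exists_isSmoothEmbedding_range_eq (a := b₂) ⟨hb₂0, hb₂1⟩ hregb₂
  haveI : Nonempty V := by
    obtain ⟨x, hx⟩ : b ∈ range g :=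
      intermediate_value_univ p q hgcont ⟨hpb.le, hbq.le⟩
    have : x ∈ range ι := by rw [hιr]; exact hx
    obtain ⟨v, -⟩ := this
    exact ⟨v⟩
  haveI : Nonempty V₂ := by
    obtain ⟨x, hx⟩ : b₂ ∈ range g :=
      intermediate_value_univ q y₁ hgcont ⟨hqb₂.le, by rw [hgy₁]; exact hb₂1.le⟩
    have : x ∈ range ι₂ := by rw [hι₂r]; exact hx
    obtain ⟨v, -⟩ := this
    exact ⟨v⟩
  ------------------------------------------------------------------------------------------
  -- Step 3: Milnor's Thm. 3.13 / §3 p. 21 — the upper level is the surgery of the lower one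
  ------------------------------------------------------------------------------------------
  have hιr' : range ι = g ⁻¹' {Ps.b} := by rw [hPb]; exact hιr
  have hι₂r' : range ι₂ = g ⁻¹' {Ps.b₂} := by rw [hPb₂]; exact hι₂r
  have hG := Ps.isOpenGluing_tube ι hι hιr' ι₂ hι₂ hι₂r'
  ------------------------------------------------------------------------------------------
  -- Step 4: the lower level is `S³`, the upper level is `∂P`
  ------------------------------------------------------------------------------------------
  obtain ⟨Φ⟩ := nonempty_diffeomorph_sphere_three_of_level hgA hgcrit hpmem.2 hpb hbq hb1 V ι hι hιr
  have hrange₂ : range ι₂ = (fun z => 1 - g z) ⁻¹' {1 - b₂} := by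
    rw [hι₂r]
    ext z
    simp only [mem_preimage, mem_singleton_iff]
    show s * f z + (1 - s) = b₂ ↔ 1 - (s * f z + (1 - s)) = 1 - b₂
    constructor
    · intro h; linarith
    · intro h; linarith
  obtain ⟨e₂⟩ := hlev (1 - b₂) (by linarith) hb₂ε V₂ ι₂ hι₂ hrange₂
  -- transport the gluing to `∂P`
  have hG₁ := IsOpenGluing.of_diffeomorph_of_range_eq rfl hG e₂.symm
  ------------------------------------------------------------------------------------------
  -- Step 5: the tube and the knot in `S³`; transport of the two pieces
  ------------------------------------------------------------------------------------------
  set T : (Metric.sphere (0 : EuclideanSpace ℝ (Fin 2)) 1) × (EuclideanSpace ℝ (Fin 2)) → (Metric.sphere (0 : EuclideanSpace ℝ (Fin 4)) 1) :=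
    ⇑Φ ∘ ⇑(Ps.tubePH ι hι hιr') with hTdef
  have hT : Manifold.IsSmoothEmbedding ((𝓡 1).prod 𝓘(ℝ, (EuclideanSpace ℝ (Fin 2)))) (𝓡 3) ∞ T :=
    (Ps.isSmoothEmbedding_tubePH ι hι hιr').diffeomorph_comp Φ
  set K : Knot := LickorishTwist.knotOfTube hT with hKdef
  have hK : ∀ x, K x = Φ (Ps.sphereEmb ι hι hιr' x) := fun x => by
    show T (x, 0) = _
    rw [hTdef, Function.comp_apply, Ps.tubePH_zero ι hι hιr' x]
  -- the complement of `K` is the complement of the left-hand circle, along `Φ`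
  have hmemA : ∀ a : K.complement, Φ.symm (a : (Metric.sphere (0 : EuclideanSpace ℝ (Fin 4)) 1)) ∈ Ps.coreCompl ι hι hιr' := by
    intro a
    show Φ.symm (a : (Metric.sphere (0 : EuclideanSpace ℝ (Fin 4)) 1)) ∈ (range (Ps.sphereEmb ι hι hιr'))ᶜ
    rintro ⟨σ, hσ⟩
    have ha := a.2
    rw [SphereEmbedding.mem_complement_iff] at ha
    refine ha ⟨σ, ?_⟩
    rw [hK, hσ, Diffeomorph.apply_symm_apply]
  have hmemA' : ∀ v : Ps.coreCompl ι hι hιr', Φ (v : V) ∈ K.complement := by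
    intro v
    rw [SphereEmbedding.mem_complement_iff]
    rintro ⟨σ, hσ⟩
    rw [hK] at hσ
    have hv : (v : V) ∈ (range (Ps.sphereEmb ι hι hιr'))ᶜ := v.2
    exact hv ⟨σ, Φ.injective hσ⟩
  let α : K.complement ≃ₘ⟮𝓡 3, 𝓡 3⟯ (Ps.coreCompl ι hι hιr') :=
    { toFun := fun a => ⟨Φ.symm a, hmemA a⟩
      invFun := fun v => ⟨Φ v, hmemA' v⟩
      left_inv := fun a => Subtype.ext (Φ.apply_symm_apply _)
      right_inv := fun v => Subtype.ext (Φ.symm_apply_apply _)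
      contMDiff_toFun := (ContMDiff.subtypeVal_comp_iff (Ps.coreCompl ι hι hιr') _).1
        (Φ.symm.contMDiff.comp contMDiff_subtype_val)
      contMDiff_invFun := (ContMDiff.subtypeVal_comp_iff K.complement _).1
        (Φ.contMDiff.comp contMDiff_subtype_val) }
  -- the open solid torus is Milnor's `OD² × S¹`
  have hmemB : ∀ x : ↥solidTorus,
      ((x : (EuclideanSpace ℝ (Fin 2)) × (Metric.sphere (0 : EuclideanSpace ℝ (Fin 2)) 1)) : EuclideanSpace ℝ (Fin (1 + 1)) ×
        (Metric.sphere (0 : EuclideanSpace ℝ (Fin (3 - 1 - 1 + 1))) 1)) ∈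
        Cobordism.PassageSetting.ballSphere 3 1 := by
    intro x
    have hx := x.2
    rw [mem_solidTorus_iff] at hx
    exact hx
  have hmemB' : ∀ x : ↥(Cobordism.PassageSetting.ballSphere 3 1),
      ((x : EuclideanSpace ℝ (Fin (1 + 1)) ×
        (Metric.sphere (0 : EuclideanSpace ℝ (Fin (3 - 1 - 1 + 1))) 1)) : (EuclideanSpace ℝ (Fin 2)) × (Metric.sphere (0 : EuclideanSpace ℝ (Fin 2)) 1)) ∈
        solidTorus := by
    intro x
    rw [mem_solidTorus_iff]
    exact x.2
  let β : ↥solidTorus ≃ₘ⟮𝓘(ℝ, (EuclideanSpace ℝ (Fin 2))).prod (𝓡 1),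
      𝓘(ℝ, EuclideanSpace ℝ (Fin (1 + 1))).prod (𝓡 (3 - 1 - 1))⟯
      ↥(Cobordism.PassageSetting.ballSphere 3 1) :=
    { toFun := fun x => ⟨_, hmemB x⟩
      invFun := fun x => ⟨_, hmemB' x⟩
      left_inv := fun x => rfl
      right_inv := fun x => rfl
      contMDiff_toFun :=
        (ContMDiff.subtypeVal_comp_iff (Cobordism.PassageSetting.ballSphere 3 1) _).1
          contMDiff_subtype_val
      contMDiff_invFun := (ContMDiff.subtypeVal_comp_iff solidTorus _).1 contMDiff_subtype_val }
  have hG₂ := hG₁.comp_diffeomorph_pieces α β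
  -- the transported relation is the relation of the tube `T`
  have hG₃ : IsOpenGluing (𝓡 3) (𝓘(ℝ, (EuclideanSpace ℝ (Fin 2))).prod (𝓡 1)) (𝓡 3)
      (A := K.complement) (B := solidTorus) (P := (𝓡∂ (3 + 1)).boundary P)
      fun a b => LickorishTwist.tubeRel T (a : (Metric.sphere (0 : EuclideanSpace ℝ (Fin 4)) 1)) (b : (EuclideanSpace ℝ (Fin 2)) × (Metric.sphere (0 : EuclideanSpace ℝ (Fin 2)) 1)) := by
    refine hG₂.of_forall_iff fun a x => ?_
    show (∃ (σ : (Metric.sphere (0 : EuclideanSpace ℝ (Fin 2)) 1)) (t : ℝ), t ∈ Ioo (0 : ℝ) 1 ∧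
        ((x : (EuclideanSpace ℝ (Fin 2)) × (Metric.sphere (0 : EuclideanSpace ℝ (Fin 2)) 1))).1 = t • (σ : (EuclideanSpace ℝ (Fin 2))) ∧
        Φ.symm (a : (Metric.sphere (0 : EuclideanSpace ℝ (Fin 4)) 1)) = Ps.tubePH ι hι hιr' (σ, t • (((x : (EuclideanSpace ℝ (Fin 2)) × (Metric.sphere (0 : EuclideanSpace ℝ (Fin 2)) 1))).2 : (EuclideanSpace ℝ (Fin 2))))) ↔
      ∃ (u : (Metric.sphere (0 : EuclideanSpace ℝ (Fin 2)) 1)) (t : ℝ), t ∈ Ioo (0 : ℝ) 1 ∧ ((x : (EuclideanSpace ℝ (Fin 2)) × (Metric.sphere (0 : EuclideanSpace ℝ (Fin 2)) 1))).1 = t • (u : (EuclideanSpace ℝ (Fin 2))) ∧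
        (a : (Metric.sphere (0 : EuclideanSpace ℝ (Fin 4)) 1)) = T (u, t • (((x : (EuclideanSpace ℝ (Fin 2)) × (Metric.sphere (0 : EuclideanSpace ℝ (Fin 2)) 1))).2 : (EuclideanSpace ℝ (Fin 2))))
    refine exists_congr fun σ => exists_congr fun t => and_congr_right fun _ =>
      and_congr_right fun _ => ⟨fun h => ?_, fun h => ?_⟩
    · exact (Φ.apply_symm_apply _).symm.trans (congrArg Φ h)
    · exact Φ.injective ((Φ.apply_symm_apply _).trans h)
  ------------------------------------------------------------------------------------------
  -- Step 6: orient the tube, read off the framing, and pass to the given boundary datum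
  ------------------------------------------------------------------------------------------
  obtain ⟨ν, m, hν, hm, hsurg⟩ :=
    exists_tubularNbhd_hasFraming_isIntegralSurgery_of_isOpenGluing_tubeRel hT hG₃
  let e₃ : ((𝓡∂ (3 + 1)).boundary P) ≃ₘ⟮𝓡 3, 𝓡 3⟯ bP.carrier :=
    (BoundaryManifold.boundaryData 3 P).restrictDiffeomorph bP (Diffeomorph.refl (𝓡∂ (3 + 1)) P ∞)
  exact ⟨g, hg, p, q, hgcrit, hpmem.2, hqmem.2, ξ, hξ, Ps, hPq, V, inferInstance, inferInstance,
    inferInstance, inferInstance, inferInstance, ι, hι, hιr', Φ, ν, m, hν, hm,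
    hsurg.of_diffeomorph IsOpenGluing.of_diffeomorph_holds_self e₃⟩

/-- **The boundary of a `4`-dimensional `(1,0,1)`-handlebody is an integral surgery on a knot in
`S³`** — clause (i) of the named fact `exists_framedKnot_of_hasHandleDecomposition_oneZeroOne`.
Kirby, *The topology of 4-manifolds* (1989), Ch. I §1 (handles `B^k × B^{4-k}` attached along
framed spheres in `∂B⁴ = S³`; handlebodies correspond to Morse functions) and §2, p. 8 (`M_L` is
a smooth `4`-manifold with boundary `∂M_L`, the surgery on the framed link `L`); the mechanism is
Milnor, *Lectures on the h-cobordism theorem* (1965), Thm. 3.13 with §3 p. 21 (the level above a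
critical point of index `2` is the surgery of the level below along the tube of the left-hand
circle, `Cobordism.PassageSetting.isOpenGluing_tube`), Thm. 3.4 / Cor. 3.5 (the top level is the
boundary) and *Morse theory* (1963), Thm. 3.1 (the bottom level is `∂B⁴ = S³`).  See the module
docstring for the assembly. [cite: Kirby1989, Ch. I §1 and §2 (p. 8)]
[cite: MilnorHCobordism1965, Thm. 3.13 with §3 p. 21, Thm. 3.4 and Cor. 3.5]
[cite: Milnor1963, Thm. 3.1] -/
theorem exists_knot_isIntegralSurgery_of_hasHandleDecomposition_oneZeroOne
    (P : Type) [TopologicalSpace P] [T2Space P] [SecondCountableTopology P]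
    [ChartedSpace (EuclideanHalfSpace 4) P] [IsManifold (𝓡∂ 4) ∞ P] [CompactSpace P]
    (hP : HasHandleDecomposition 3 P (fun k => if k = 0 then 1 else if k = 2 then 1 else 0))
    (bP : BoundaryData (𝓡∂ 4) P (𝓡 3)) :
    ∃ (K : Knot) (n : ℤ), IsIntegralSurgery (𝓡 3) bP.carrier K n := by
  obtain ⟨g, -, p, q, -, -, -, ξ, -, Ps, -, V, _, _, _, _, _, ι, hι, hιr, Φ, ν, n, -, -, hsurg⟩ :=
    exists_passageData_isIntegralSurgery_of_hasHandleDecomposition_oneZeroOne P hP bP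
  exact ⟨_, n, hsurg⟩

/-- **The fact from its closing clause.**  The named fact
`exists_framedKnot_of_hasHandleDecomposition_oneZeroOne` (`PropertyRTraceClosing.lean`) follows
from clause (i) (`exists_passageData_isIntegralSurgery_of_hasHandleDecomposition_oneZeroOne`) and
the closing clause (ii) FOR THE KNOT OF THAT CONSTRUCTION, spelled out as the hypothesis `hC`
(not vendored as a named fact): *for a `(1,0,1)`-handlebody `P` presented as above, if the
transported left-hand circle `K = Φ ∘ S_L(q)` is unknotted in `S³` and the framing integer of the
transported tube is `0`, then the round `4`-sphere splits as `S⁴ = P ∪_{φ'} V'` with `V'` a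
compact connected orientable `(1,1)`-handlebody* — Kirby (1989), Ch. I §2, p. 8: *"Adding a
2-handle to an unknot with zero framing gives `S² × B²`, also with boundary `S¹ × S²`"*, together
with `S⁴ = S² × B² ∪ S¹ × B³` and the uniqueness of attaching a `2`-handle along framed-isotopic
circles (Kosinski 1993, VI (6.6), (7.2)).  The residue `hC` is what remains to discharge the
fact. [cite: Kirby1989, Ch. I §2, p. 8] [cite: Kosinski1993, VI (6.6) and (7.2)] -/
theorem exists_framedKnot_of_hasHandleDecomposition_oneZeroOne_of_closing
    (hC : ∀ (P : Type) [TopologicalSpace P] [T2Space P] [SecondCountableTopology P]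
      [ChartedSpace (EuclideanHalfSpace 4) P] [IsManifold (𝓡∂ 4) ∞ P] [CompactSpace P]
      (bP : BoundaryData (𝓡∂ 4) P (𝓡 3))
      (g : P → ℝ) (_ : (Cobordism.ofBoundary 3 P).IsMorseFunction g) (p q : P)
      (_ : criticalSet (𝓡∂ (3 + 1)) g = {p, q}) (_ : morseIndex (𝓡∂ (3 + 1)) g p = 0)
      (_ : morseIndex (𝓡∂ (3 + 1)) g q = 2)
      (ξ : Cₛ^∞⟮𝓡∂ (3 + 1); EuclideanSpace ℝ (Fin (3 + 1)),
        (TangentSpace (𝓡∂ (3 + 1)) : P → Type)⟯)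
      (_ : IsGradientLike (𝓡∂ (3 + 1)) g ξ)
      (Ps : Cobordism.PassageSetting (Cobordism.ofBoundary 3 P) g ⇑ξ 1) (_ : Ps.q = q)
      (V : Type) [TopologicalSpace V] [T2Space V] [ChartedSpace (EuclideanSpace ℝ (Fin 3)) V]
      [IsManifold (𝓡 3) ∞ V] [Nonempty V] (ι : V → P)
      (hι : Manifold.IsSmoothEmbedding (𝓡 3) (𝓡∂ (3 + 1)) ∞ ι) (hιr : range ι = g ⁻¹' {Ps.b})
      (Φ : V ≃ₘ⟮𝓡 3, 𝓡 3⟯ (Metric.sphere (0 : EuclideanSpace ℝ (Fin 4)) 1))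
      (ν : Knot.TubularNbhd
        ⇑(LickorishTwist.knotOfTube ((Ps.isSmoothEmbedding_tubePH ι hι hιr).diffeomorph_comp Φ)))
      (n : ℤ),
      (⇑ν = ⇑Φ ∘ ⇑(Ps.tubePH ι hι hιr) ∨ ⇑ν = fibreReflect (⇑Φ ∘ ⇑(Ps.tubePH ι hι hιr))) →
      ν.HasFraming n →
      (LickorishTwist.knotOfTube ((Ps.isSmoothEmbedding_tubePH ι hι hιr).diffeomorph_comp Φ)).IsUnknot →
      n = 0 →
      ∃ (V' : Type) (_ : TopologicalSpace V') (_ : T2Space V') (_ : SecondCountableTopology V')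
        (_ : ChartedSpace (EuclideanHalfSpace 4) V') (_ : IsManifold (𝓡∂ 4) ∞ V')
        (_ : CompactSpace V') (_ : ConnectedSpace V') (bV' : BoundaryData (𝓡∂ 4) V' (𝓡 3))
        (φ' : bP.carrier ≃ₘ⟮𝓡 3, 𝓡 3⟯ bV'.carrier),
        HasHandleDecomposition 3 V' (handleCount 1 1) ∧ IsOrientable (𝓡∂ 4) V' ∧
          IsBoundaryGluing bP bV' φ' (𝓡 4) (Metric.sphere (0 : EuclideanSpace ℝ (Fin 5)) 1)) :
    exists_framedKnot_of_hasHandleDecomposition_oneZeroOne := by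
  intro P _ _ _ _ _ _ hP bP
  obtain ⟨g, hg, p, q, hcrit, hp, hq, ξ, hξ, Ps, hPq, V, _, _, _, _, _, ι, hι, hιr, Φ, ν, n, hν, hn,
    hsurg⟩ := exists_passageData_isIntegralSurgery_of_hasHandleDecomposition_oneZeroOne P hP bP
  exact ⟨_, n, hsurg, fun hU h0 =>
    hC P bP g hg p q hcrit hp hq ξ hξ Ps hPq V ι hι hιr Φ ν n hν hn hU h0⟩

/-- **The fact from a closed-up model and the uniqueness of the trace.**  Clause (ii) of
`exists_framedKnot_of_hasHandleDecomposition_oneZeroOne` splits into two pieces of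
`4`-dimensional handle theory, and the fact follows from them (this theorem): (1) a MODEL — any
compact `4`-manifold with boundary `P₀` which is one piece of a splitting of the round sphere
`S⁴ = P₀ ∪_{φ₀} V₀` whose other piece `V₀` is a compact connected orientable `(1,1)`-handlebody
(Kirby 1989, Ch. I §2, p. 8: `S⁴ = S² × B² ∪ S¹ × B³`; supplied in the tree by
`exists_isBoundaryGluing_sphereFour_oneZeroOne_oneOne`, `SphereFourOneZeroOneSplitting.lean`,
with `P₀` itself a compact connected orientable `(1,0,1)`-handlebody); (2) UNIQUENESS OF THE
TRACE OF THE `0`-FRAMED UNKNOT (hypothesis `hU`): every `(1,0,1)`-handlebody `P` presented as in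
`exists_passageData_isIntegralSurgery_of_hasHandleDecomposition_oneZeroOne` whose transported
left-hand circle is unknotted in `S³` with framing integer `0` is diffeomorphic to `P₀` (Kirby,
loc. cit.: *"Adding a 2-handle to an unknot with zero framing gives `S² × B²`"*; uniqueness of
attaching a `2`-handle along framed-isotopic circles, Kosinski 1993, VI (6.6), (7.2)).  The
splitting is transported along the diffeomorphism (`IsBoundaryGluing.transfer`, its boundary
restriction `BoundaryData.restrictDiffeomorph`, Lee 2013, Thm. 5.11).
[cite: Kirby1989, Ch. I §2, p. 8] [cite: Kosinski1993, VI (6.6) and (7.2)] -/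
theorem exists_framedKnot_of_hasHandleDecomposition_oneZeroOne_of_model
    (P₀ : Type) [TopologicalSpace P₀] [ChartedSpace (EuclideanHalfSpace 4) P₀] [IsManifold (𝓡∂ 4) ∞ P₀]
    (V₀ : Type) [TopologicalSpace V₀] [T2Space V₀] [SecondCountableTopology V₀]
    [ChartedSpace (EuclideanHalfSpace 4) V₀] [IsManifold (𝓡∂ 4) ∞ V₀] [CompactSpace V₀]
    [ConnectedSpace V₀] (hV₀ : HasHandleDecomposition 3 V₀ (handleCount 1 1))
    (hoV₀ : IsOrientable (𝓡∂ 4) V₀) (bP₀ : BoundaryData (𝓡∂ 4) P₀ (𝓡 3))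
    (bV₀ : BoundaryData (𝓡∂ 4) V₀ (𝓡 3)) (φ₀ : bP₀.carrier ≃ₘ⟮𝓡 3, 𝓡 3⟯ bV₀.carrier)
    (hS : IsBoundaryGluing bP₀ bV₀ φ₀ (𝓡 4) (Metric.sphere (0 : EuclideanSpace ℝ (Fin 5)) 1))
    (hU : ∀ (P : Type) [TopologicalSpace P] [T2Space P] [SecondCountableTopology P]
      [ChartedSpace (EuclideanHalfSpace 4) P] [IsManifold (𝓡∂ 4) ∞ P] [CompactSpace P]
      (g : P → ℝ) (_ : (Cobordism.ofBoundary 3 P).IsMorseFunction g) (p q : P)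
      (_ : criticalSet (𝓡∂ (3 + 1)) g = {p, q}) (_ : morseIndex (𝓡∂ (3 + 1)) g p = 0)
      (_ : morseIndex (𝓡∂ (3 + 1)) g q = 2)
      (ξ : Cₛ^∞⟮𝓡∂ (3 + 1); EuclideanSpace ℝ (Fin (3 + 1)),
        (TangentSpace (𝓡∂ (3 + 1)) : P → Type)⟯)
      (_ : IsGradientLike (𝓡∂ (3 + 1)) g ξ)
      (Ps : Cobordism.PassageSetting (Cobordism.ofBoundary 3 P) g ⇑ξ 1) (_ : Ps.q = q)
      (V : Type) [TopologicalSpace V] [T2Space V] [ChartedSpace (EuclideanSpace ℝ (Fin 3)) V]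
      [IsManifold (𝓡 3) ∞ V] [Nonempty V] (ι : V → P)
      (hι : Manifold.IsSmoothEmbedding (𝓡 3) (𝓡∂ (3 + 1)) ∞ ι) (hιr : range ι = g ⁻¹' {Ps.b})
      (Φ : V ≃ₘ⟮𝓡 3, 𝓡 3⟯ (Metric.sphere (0 : EuclideanSpace ℝ (Fin 4)) 1))
      (ν : Knot.TubularNbhd
        ⇑(LickorishTwist.knotOfTube ((Ps.isSmoothEmbedding_tubePH ι hι hιr).diffeomorph_comp Φ)))
      (n : ℤ),
      (⇑ν = ⇑Φ ∘ ⇑(Ps.tubePH ι hι hιr) ∨ ⇑ν = fibreReflect (⇑Φ ∘ ⇑(Ps.tubePH ι hι hιr))) →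
      ν.HasFraming n →
      (LickorishTwist.knotOfTube ((Ps.isSmoothEmbedding_tubePH ι hι hιr).diffeomorph_comp Φ)).IsUnknot →
      n = 0 →
      Nonempty (P ≃ₘ⟮𝓡∂ 4, 𝓡∂ 4⟯ P₀)) :
    exists_framedKnot_of_hasHandleDecomposition_oneZeroOne := by
  refine exists_framedKnot_of_hasHandleDecomposition_oneZeroOne_of_closing
    fun P _ _ _ _ _ _ bP g hg p q hcrit hp hq ξ hξ Ps hPq V _ _ _ _ _ ι hι hιr Φ ν n hν hn hK h0 => ?_
  obtain ⟨e⟩ := hU P g hg p q hcrit hp hq ξ hξ Ps hPq V ι hι hιr Φ ν n hν hn hK h0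
  exact ⟨V₀, inferInstance, inferInstance, inferInstance, inferInstance, inferInstance, inferInstance,
    inferInstance, bV₀, (bP.restrictDiffeomorph bP₀ e).trans φ₀, hV₀, hoV₀, by
      rw [Diffeomorph.coe_trans]; exact hS.transfer e⟩

end Main

end Literature.Topology.FourManifolds

end
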